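import Summits.BirchSwinnertonDyer.BirchSwinnertonDyer.Theorems.AlignedTransportAtTwoMainConjectureOfRankZeroBSDAtTwoHalfDescentLayerIndexCriterion
import Summits.BirchSwinnertonDyer.BirchSwinnertonDyer.Theorems.AlignedTransportAtTwoMainConjectureOfRankZeroBSDAtTwoHalfDescentLayerIndexCertificateLayer
import Summits.BirchSwinnertonDyer.Rank1Residual.X1.GeneratorBound
import HarnessLib

/-!
# Route `AlignedTransportAtTwo`, crux C2 `MainConjectureOfRankZeroBSDAtTwo` (stmt-BirchSwinnertonDyer-22298):
# THE DESCENT NUMBER WITHOUT GREENBERG 4.14, VIII — `μ = 0 ⟺` THE DESCENT NUMBERS ARE BOUNDED, and the INVARIANTS CRITERION in a rank-0 tower: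
# for EVERY f.g. torsion `X`, `μ(X) = 0 ⟺ (#(X/Ψ_n X))_n` is bounded; and when `f` is coprime to every `ω_n` (`f(0) ≠ 0`, `Ψ_m ∤ f`),
# `μ(X) = 0 ⟺ ∃ n, 0 < #(X/ω_{n+1} X) < p^{pⁿ(p−1)}` — in Selmer currency `μ(X(E/K_∞)) = 0 ⟺` SOME layer has `0 < #Sel_{p^∞}(E/K_∞)^{Γ_{n+1}} < p^{pⁿ(p−1)}`

HONEST FRAMING (cell `bsd-f1-sign2`, WIDTH-5 attached prover seat `bsd-line-att-p5` gen 55 on line `birth` of the lead `bsd-line-att-p2`;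
`--supports` stmt-BirchSwinnertonDyer-22298, closes nothing; BSD is NOT proved by any of this; the crux C2, its verdict «blocked-on
`Rank1Residual.GreenbergMuConjectureIrreducible`» and every registered stub (P / T / Kμ / LimDoor / MuIneqʳ / PFμ⁺) are untouched). THEOREMS ONLY — no `def`,
no instance, no named fact, no `sorry`; route-independent. Sequel of this gen's files I–VII (`#(X/Ψ_nX) = p^{φμ+λ}·#(F/Ψ_nF)`; `p^{φμ} ∣ #(X/Ψ_nX)` unconditionally;
`μ = 0 ⟺ ∃ n, 0 < #(X/Ψ_nX) < p^{φ}`; `0 < #(X/ω_{n+1}X) < p^{φ} ⟹ μ = 0`), of g54's `…HalfDescentLayerIndexTower` (Iwasawa's theorem exact for `X` without finite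
submodule: `#(X/ω_nX)·p^{μp^{n₀}+λn₀} = #(X/ω_{n₀}X)·p^{μpⁿ+λn}`, `ω_n` regular) and of the tree's `X1/GeneratorBound.natCard_coinvariants_eq` (`X/TX` finite when `f(0) ≠ 0`).

* §1 ★★ **`mu_eq_zero_iff_bddAbove_natCard_layerQuotient`: `μ(f) = 0 ⟺ ∃ B, ∀ n, #(X/Ψ_n X) ≤ B`** (`X` ANY f.g. torsion, `char_Λ X = (f)`): for `μ = 0` the index is
  `p^{λ}·#(F/Ψ_nF) ≤ p^{λ}·#F` at every high layer (file I), for `μ ≥ 1` it is a positive multiple of `p^{pⁿ(p−1)}` (file III); `muInvariant_…` form; Selmer form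
  ★★ **`mu_eq_zero_iff_bddAbove_natCard_endInvariants_relNorm`: `μ(X(E/K_∞)) = 0 ⟺` the relative-norm kernels `#ker(N_n | Sel_{p^∞}(E/K_∞))` are bounded in `n`**.
* §2 (rank-0 tower: `f(0) ≠ 0`, `Ψ_m ∤ f` for all `m` — i.e. every `X/ω_nX` finite) ★★★ **`mu_eq_zero_iff_exists_natCard_quotient_omega_succ_pos_lt`:
  `μ(f) = 0 ⟺ ∃ n, 0 < #(X/ω_{n+1}X) < p^{pⁿ(p−1)}`** (`⟹`: `#(X/ω_{n+1}X) = #(X'/ω_{n+1}X')·#(F/ω_{n+1}F) ≤ C·p^{λ(n+1)}·#F` by Iwasawa exact for `X' = X/F`, and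
  `C'·p^{λ(n+1)} < p^{pⁿ(p−1)}` for `n` large; `⟸`: file VI); Selmer form ★★★ **`mu_eq_zero_iff_exists_natCard_selmerInvariants_pos_lt`:
  `μ(X(E/K_∞)) = 0 ⟺ ∃ n, 0 < #Sel_{p^∞}(E/K_∞)^{Γ_{n+1}} < p^{pⁿ(p−1)}`** (dual datum with `X` f.g. torsion, `char X = (f)`, `f` coprime to all `ω_n`).
Reading for C2 (`p = 2`): on a rank-0 seed (all `Sel_{2^∞}(W/ℚ_n)` finite) Greenberg's `μ₂ = 0` ⟺ «at SOME layer the limit Selmer group has fewer than `2^{2ⁿ}`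
`Γ_{n+1}`-invariant classes» ⟺ «the relative-norm kernels stay bounded up the tower». Nothing is computed for any curve. Memo
`Cruxes/MainConjectureOfRankZeroBSDAtTwo/LAYER-INDEX-FINITE-att-p5-g55.md`.

References: R. Greenberg, LNM 1716 (1999), §1 pp. 60–65, Thm. 1.10, Conj. 1.11, §4 Lemma 4.2 and p. 117 [GreenbergLNM1716]; L. Washington, GTM 83, §13.3 Thm. 13.13
[Washington1997]; J. Neukirch, A. Schmidt, K. Wingberg, (5.3.17) [NeukirchSchmidtWingberg2008].
-/

set_option linter.dupNamespace false
set_option autoImplicit false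

noncomputable section

open scoped Classical AddSubgroup Polynomial

universe u

namespace Summit.BirchSwinnertonDyer.BirchSwinnertonDyer.Theorems.AlignedTransportAtTwoHalfDescentLayerIndexBounded

open WeierstrassCurve Literature.NumberTheory.EllipticCurves Literature.NumberTheory.EllipticCurves.IwasawaDual
  Literature.NumberTheory.EllipticCurves.IwasawaAlgebra
  Summit.BirchSwinnertonDyer.Rank1Residual.X1.MuLambda
  Summit.BirchSwinnertonDyer.Rank1Residual.X1.GeneratorBoundMu
  Summit.BirchSwinnertonDyer.Rank1Residual.Iwasawa
  Summit.BirchSwinnertonDyer.BirchSwinnertonDyer.Theorems.DefectPrime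
  Summit.BirchSwinnertonDyer.BirchSwinnertonDyer.Theorems.AlignedTransportAtTwoCyclotomicLayerPrime
  Summit.BirchSwinnertonDyer.BirchSwinnertonDyer.Theorems.AlignedTransportAtTwoHalfDescentLayerIndex
  Summit.BirchSwinnertonDyer.BirchSwinnertonDyer.Theorems.AlignedTransportAtTwoHalfDescentLayerIndexModule
  Summit.BirchSwinnertonDyer.BirchSwinnertonDyer.Theorems.AlignedTransportAtTwoHalfDescentLayerIndexTower
  Summit.BirchSwinnertonDyer.BirchSwinnertonDyer.Theorems.AlignedTransportAtTwoHalfDescentLayerIndexFinite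
  Summit.BirchSwinnertonDyer.BirchSwinnertonDyer.Theorems.AlignedTransportAtTwoHalfDescentLayerIndexSelmer
  Summit.BirchSwinnertonDyer.BirchSwinnertonDyer.Theorems.AlignedTransportAtTwoHalfDescentLayerIndexCertificate
  Summit.BirchSwinnertonDyer.BirchSwinnertonDyer.Theorems.AlignedTransportAtTwoHalfDescentLayerIndexCertificateSelmer
  Summit.BirchSwinnertonDyer.BirchSwinnertonDyer.Theorems.AlignedTransportAtTwoHalfDescentLayerIndexCertificateLayer
  Summit.BirchSwinnertonDyer.BirchSwinnertonDyer.Theorems.AlignedTransportAtTwoHalfDescentLayerIndexCriterion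

/-! ## §1 `μ = 0 ⟺` the layer indices are bounded -/

section Bounded

variable {p : ℕ} [hp : Fact p.Prime] {M : Type u} [AddCommGroup M] [Module (IwasawaAlgebra p) M]

/-- ★★ **`μ(f) = 0 ⟺` THE DESCENT NUMBERS `#(X/Ψ_n X)` ARE BOUNDED IN `n`** (`X` ANY f.g. torsion `Λ`-module, `char_Λ X = (f)`; `Nat.card`). `⟹`: from the first high
layer on, `#(X/Ψ_nX) = p^{λ}·#(F/Ψ_nF) ≤ p^{λ}·#F` (`F` the largest finite submodule); `⟸`: if `μ ≥ 1` then at the layer `n = B + λ + 1` the index is a positive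
multiple of `p^{pⁿ(p−1)} > B`. [cite: Washington1997, §13.3 Thm. 13.13] [cite: GreenbergLNM1716, Conj. 1.11] -/
theorem mu_eq_zero_iff_bddAbove_natCard_layerQuotient [Module.Finite (IwasawaAlgebra p) M] (hM : Module.IsTorsion (IwasawaAlgebra p) M)
    {f : IwasawaAlgebra p} (hchar : Literature.NumberTheory.EllipticCurves.Module.charIdeal (IwasawaAlgebra p) M = Ideal.span {f}) :
    mu f = 0 ↔ ∃ B : ℕ, ∀ n : ℕ,
      Nat.card (M ⧸ (Ideal.span {(((Polynomial.cyclotomic (p ^ (n + 1)) ℤ_[p]).comp (Polynomial.X + 1) : ℤ_[p][X]) : IwasawaAlgebra p)} • ⊤ :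
        Submodule (IwasawaAlgebra p) M)) ≤ B := by
  haveI : IsNoetherian (IwasawaAlgebra p) M := inferInstance
  obtain ⟨F, hFfin, hFmax⟩ := exists_finite_submodule_forall_finite_le (R := IwasawaAlgebra p) (M := M)
  haveI : Finite F := hFfin
  have hF := forall_finite_eq_bot_quotient_of_forall_finite_le F hFmax
  -- a layer `n > λ` is high: `λ < n < pⁿ ≤ pⁿ(p−1)`
  have hhigh : ∀ n, lam f < n → lam f < p ^ n * (p - 1) := fun n hn ↦ by
    have h1 : n < p ^ n := Nat.lt_pow_self hp.out.one_lt
    have h2 : p ^ n ≤ p ^ n * (p - 1) := Nat.le_mul_of_pos_right _ (by have := hp.out.two_le; omega)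
    omega
  constructor
  · intro hμ
    -- bound: the low layers individually, the high layers by `p^λ · #F`
    refine ⟨p ^ lam f * Nat.card F + ∑ m ∈ Finset.range (lam f + 1),
      Nat.card (M ⧸ (Ideal.span {(((Polynomial.cyclotomic (p ^ (m + 1)) ℤ_[p]).comp (Polynomial.X + 1) : ℤ_[p][X]) : IwasawaAlgebra p)} • ⊤ :
        Submodule (IwasawaAlgebra p) M)), fun n ↦ ?_⟩
    by_cases hn : lam f < n
    · have h := (natCard_quotient_smul_top_le (cyclotomic_comp_isDistinguishedAt_maximalIdeal p n) (constantCoeff_cyclotomicLayer p n)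
        (prime_coe_cyclotomic_comp p n) hM F hF hchar (by rw [natDegree_cyclotomicLayer]; exact hhigh n hn)).2
      rw [natDegree_cyclotomicLayer, hμ, mul_zero, zero_add] at h
      exact h.trans (Nat.le_add_right _ _)
    · have hmem : n ∈ Finset.range (lam f + 1) := Finset.mem_range.mpr (by omega)
      exact (Finset.single_le_sum (f := fun m ↦ Nat.card (M ⧸ (Ideal.span {(((Polynomial.cyclotomic (p ^ (m + 1)) ℤ_[p]).comp (Polynomial.X + 1) :
          ℤ_[p][X]) : IwasawaAlgebra p)} • ⊤ : Submodule (IwasawaAlgebra p) M))) (fun _ _ ↦ Nat.zero_le _) hmem).trans (Nat.le_add_left _ _)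
  · rintro ⟨B, hB⟩
    by_contra hμ
    have h1 : 1 ≤ mu f := Nat.one_le_iff_ne_zero.mpr hμ
    set n : ℕ := B + lam f + 1 with hn
    have hlam : lam f < p ^ n * (p - 1) := hhigh n (by omega)
    obtain ⟨hdvd, hfin⟩ := pow_dvd_natCard_layerQuotient hM hchar hlam
    haveI := hfin
    have hpos : 0 < Nat.card (M ⧸ (Ideal.span {(((Polynomial.cyclotomic (p ^ (n + 1)) ℤ_[p]).comp (Polynomial.X + 1) : ℤ_[p][X]) : IwasawaAlgebra p)} • ⊤ :
        Submodule (IwasawaAlgebra p) M)) := Nat.card_pos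
    have hle := Nat.le_of_dvd hpos hdvd
    have hB' := hB n
    -- `p^{pⁿ(p−1)} > n > B`
    have hnlt : n < p ^ n := Nat.lt_pow_self hp.out.one_lt
    have hφ : p ^ n ≤ p ^ n * (p - 1) := Nat.le_mul_of_pos_right _ (by have := hp.out.two_le; omega)
    have hexp : n ≤ p ^ n * (p - 1) * mu f + lam f := by nlinarith
    have hpow : p ^ n ≤ p ^ (p ^ n * (p - 1) * mu f + lam f) := Nat.pow_le_pow_right hp.out.pos hexp
    omega

/-- ★★ **`μ(X) = 0 ⟺` the descent numbers `#(X/Ψ_n X)` are bounded** (module form, generator hidden). [cite: Washington1997, §13.2–13.3] [cite: GreenbergLNM1716, Conj. 1.11] -/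
theorem muInvariant_eq_zero_iff_bddAbove_natCard_layerQuotient [Module.Finite (IwasawaAlgebra p) M] (hM : Module.IsTorsion (IwasawaAlgebra p) M) :
    muInvariant p M = 0 ↔ ∃ B : ℕ, ∀ n : ℕ,
      Nat.card (M ⧸ (Ideal.span {(((Polynomial.cyclotomic (p ^ (n + 1)) ℤ_[p]).comp (Polynomial.X + 1) : ℤ_[p][X]) : IwasawaAlgebra p)} • ⊤ :
        Submodule (IwasawaAlgebra p) M)) ≤ B := by
  obtain ⟨f, hf0, hchar⟩ := exists_charGenerator_ne_zero M hM
  rw [← Summit.BirchSwinnertonDyer.Rank1Residual.X1.MuPart.mu_generator_eq_muInvariant M hM hf0 hchar]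
  exact mu_eq_zero_iff_bddAbove_natCard_layerQuotient hM hchar

end Bounded

section BoundedSelmer

variable {K : Type u} [Field K] [NumberField K] (W : WeierstrassCurve K) {p : ℕ} [hp : Fact p.Prime] (κ : ZpExtension K p)
  {γ : Field.absoluteGaloisGroup K}

/-- ★★ **GREENBERG'S `μ = 0 ⟺` THE RELATIVE-NORM KERNELS ARE BOUNDED UP THE TOWER**: for any dual datum with `X` f.g. torsion,
**`μ(X(E/K_∞)) = 0 ⟺ ∃ B, ∀ n, #ker(N_n | Sel_{p^∞}(E/K_∞)) ≤ B`** (`N_n = ∑_{i<p}(conj_γ^{pⁿ})^i`; `Nat.card`, an infinite kernel counting as `0`).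
[cite: GreenbergLNM1716, §1 pp. 60–65 and Conj. 1.11] [cite: Washington1997, §13.3 Thm. 13.13] -/
theorem mu_eq_zero_iff_bddAbove_natCard_endInvariants_relNorm (hγ : κ.IsTopGenerator γ) (D : W.SelmerDualData κ γ) [Module.Finite (IwasawaAlgebra p) D.X]
    (hD : D.IsTorsion) :
    D.mu = 0 ↔ ∃ B : ℕ, ∀ n : ℕ, Nat.card ↥(endInvariants (∑ i ∈ Finset.range p, ((W.conjSelmerInfty κ γ) ^ (p ^ n)) ^ i)) ≤ B := by
  simp only [← natCard_layerQuotient_cyclotomic_eq_natCard_endInvariants W κ hγ D]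
  exact muInvariant_eq_zero_iff_bddAbove_natCard_layerQuotient (M := D.X) hD

end BoundedSelmer

/-! ## §2 The invariants criterion in a rank-0 tower: `μ = 0 ⟺ ∃ n, 0 < #(X/ω_{n+1} X) < p^{pⁿ(p−1)}` -/

section Invariants

variable {p : ℕ} [hp : Fact p.Prime] {M : Type u} [AddCommGroup M] [Module (IwasawaAlgebra p) M]

/-- (arithmetic) **`a·(n+1) + b < 2ⁿ ≤ pⁿ(p−1)` for some `n ≥ n₀`**: linear against exponential growth. [folklore] -/
theorem exists_linear_lt_pow (a b n₀ : ℕ) : ∃ n : ℕ, n₀ ≤ n ∧ a * (n + 1) + b < p ^ n * (p - 1) := by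
  set m : ℕ := 3 * a + b + n₀ + 1 with hm
  refine ⟨2 * m, by omega, ?_⟩
  have h2m : m < 2 ^ m := Nat.lt_two_pow_self
  have hsq : a * (2 * m + 1) + b < m * m := by nlinarith
  have h4 : m * m < 2 ^ m * 2 ^ m := Nat.mul_lt_mul_of_lt_of_le h2m h2m.le (by positivity)
  have hp2 : 2 ^ (2 * m) ≤ p ^ (2 * m) := Nat.pow_le_pow_left hp.out.two_le _
  have hφ : p ^ (2 * m) ≤ p ^ (2 * m) * (p - 1) := Nat.le_mul_of_pos_right _ (by have := hp.out.two_le; omega)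
  have e : 2 ^ m * 2 ^ m = 2 ^ (2 * m) := by rw [← pow_add]; ring_nf
  omega

/-- ★★★ **THE INVARIANTS CRITERION.** `X` ANY finitely generated torsion `Λ`-module with `char_Λ X = (f)`, `f` coprime to every `ω_n` (`f(0) ≠ 0` and `Ψ_m ∤ f` for all
`m` — the rank-0 tower). Then **`μ(f) = 0 ⟺ ∃ n, 0 < #(X/ω_{n+1} X) < p^{pⁿ(p−1)}`**. `⟸` is file VI; `⟹`: `#(X/ω_{n+1}X) = #(X'/ω_{n+1}X')·#(F/ω_{n+1}F)` (`X' = X/F`,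
`ω` regular on `X'`), Iwasawa exact for `X'` gives `#(X'/ω_{n+1}X') ≤ #(X'/ω_{n₀}X')·p^{λ(n+1)}` with `μ = 0`, and `C·p^{λ(n+1)} < p^{pⁿ(p−1)}` for large `n`.
[cite: Washington1997, §13.3 Thm. 13.13] [cite: GreenbergLNM1716, Thm. 1.10, Conj. 1.11, §4 Lemma 4.2] -/
theorem mu_eq_zero_iff_exists_natCard_quotient_omega_succ_pos_lt [Module.Finite (IwasawaAlgebra p) M] (hM : Module.IsTorsion (IwasawaAlgebra p) M)
    {f : IwasawaAlgebra p} (hchar : Literature.NumberTheory.EllipticCurves.Module.charIdeal (IwasawaAlgebra p) M = Ideal.span {f})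
    (h0 : PowerSeries.constantCoeff f ≠ 0)
    (hΨ : ∀ m, ¬ ((((Polynomial.cyclotomic (p ^ (m + 1)) ℤ_[p]).comp (Polynomial.X + 1) : ℤ_[p][X]) : IwasawaAlgebra p) ∣ f)) :
    mu f = 0 ↔ ∃ n : ℕ,
      0 < Nat.card (M ⧸ (Ideal.span {((1 + PowerSeries.X : PowerSeries ℤ_[p]) ^ (p ^ (n + 1)) - 1 : IwasawaAlgebra p)} • ⊤ : Submodule (IwasawaAlgebra p) M)) ∧
      Nat.card (M ⧸ (Ideal.span {((1 + PowerSeries.X : PowerSeries ℤ_[p]) ^ (p ^ (n + 1)) - 1 : IwasawaAlgebra p)} • ⊤ : Submodule (IwasawaAlgebra p) M)) <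
        p ^ (p ^ n * (p - 1)) := by
  have hf0 : f ≠ 0 := fun h ↦ h0 (by rw [h, map_zero])
  refine ⟨fun hμ ↦ ?_, fun ⟨n, hpos, hlt⟩ ↦ ?_⟩
  swap
  · rw [Summit.BirchSwinnertonDyer.Rank1Residual.X1.MuPart.mu_generator_eq_muInvariant M hM hf0 hchar]
    exact muInvariant_eq_zero_of_natCard_quotient_omega_succ_pos_lt hM hpos hlt
  -- `⟹`: split off the largest finite submodule
  haveI : IsNoetherian (IwasawaAlgebra p) M := inferInstance
  obtain ⟨F, hFfin, hFmax⟩ := exists_finite_submodule_forall_finite_le (R := IwasawaAlgebra p) (M := M)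
  haveI : Finite F := hFfin
  have hF := forall_finite_eq_bot_quotient_of_forall_finite_le F hFmax
  obtain ⟨hM', hchar'⟩ := isTorsion_and_charIdeal_quotient_eq hM F
  rw [hchar] at hchar'
  have hkill : ∀ x : M ⧸ F, f • x = 0 := smul_eq_zero_of_charIdeal_eq_span_of_noFiniteSubmodule p (M ⧸ F) hM' hF hchar'
  have hreg : ∀ n, ∀ x : M ⧸ F, (((1 + PowerSeries.X : PowerSeries ℤ_[p]) ^ (p ^ n) - 1 : IwasawaAlgebra p)) • x = 0 → x = 0 :=
    fun n ↦ omega_smul_eq_zero_imp hF hkill h0 (fun m _ ↦ hΨ m)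
  -- first high layer `n₀ = λ + 1` and Iwasawa exact for `X' = X/F`
  set n₀ : ℕ := lam f + 1 with hn₀
  have hlam₀ : lam f < p ^ n₀ * (p - 1) := by
    have h1 : n₀ < p ^ n₀ := Nat.lt_pow_self hp.out.one_lt
    have h2 : p ^ n₀ ≤ p ^ n₀ * (p - 1) := Nat.le_mul_of_pos_right _ (by have := hp.out.two_le; omega)
    omega
  set C : ℕ := Nat.card ((M ⧸ F) ⧸ (Ideal.span {((1 + PowerSeries.X : PowerSeries ℤ_[p]) ^ (p ^ n₀) - 1 : IwasawaAlgebra p)} • ⊤ :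
    Submodule (IwasawaAlgebra p) (M ⧸ F))) with hC
  -- choose `n ≥ n₀` with `λ(n+1) + (C·#F) < pⁿ(p−1)`
  obtain ⟨n, hn, hlt⟩ := exists_linear_lt_pow (p := p) (lam f) (C * Nat.card F) n₀
  have hexact := natCard_quotient_omega_mul_pow_eq (M := M ⧸ F) hM' hF hchar' h0 (n₀ := n₀) (fun m _ ↦ hΨ m) hlam₀ (n := n + 1) (by omega)
  rw [hμ, zero_mul, zero_add, zero_mul, zero_add, ← hC] at hexact
  -- `#(X'/ω_{n+1}X') ≤ C · p^{λ(n+1)}`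
  have hX'le : Nat.card ((M ⧸ F) ⧸ (Ideal.span {((1 + PowerSeries.X : PowerSeries ℤ_[p]) ^ (p ^ (n + 1)) - 1 : IwasawaAlgebra p)} • ⊤ :
      Submodule (IwasawaAlgebra p) (M ⧸ F))) ≤ C * p ^ (lam f * (n + 1)) := by
    calc _ ≤ Nat.card ((M ⧸ F) ⧸ (Ideal.span {((1 + PowerSeries.X : PowerSeries ℤ_[p]) ^ (p ^ (n + 1)) - 1 : IwasawaAlgebra p)} • ⊤ :
          Submodule (IwasawaAlgebra p) (M ⧸ F))) * p ^ (lam f * n₀) := Nat.le_mul_of_pos_right _ (pow_pos hp.out.pos _)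
      _ = C * p ^ (lam f * (n + 1)) := hexact
  -- `#(X/ω_{n+1}X) = #(X'/ω_{n+1}X') · #(F/ω_{n+1}F) ≤ C·p^{λ(n+1)}·#F`
  have hsplit := natCard_quotient_smul_top_eq_mul_of_quotient_regular F (((1 + PowerSeries.X : PowerSeries ℤ_[p]) ^ (p ^ (n + 1)) - 1 : IwasawaAlgebra p)) (hreg (n + 1))
  haveI : Finite (F ⧸ (Ideal.span {((1 + PowerSeries.X : PowerSeries ℤ_[p]) ^ (p ^ (n + 1)) - 1 : IwasawaAlgebra p)} • ⊤ : Submodule (IwasawaAlgebra p) F)) :=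
    Finite.of_surjective _ (Submodule.mkQ_surjective _)
  have hFle : Nat.card (F ⧸ (Ideal.span {((1 + PowerSeries.X : PowerSeries ℤ_[p]) ^ (p ^ (n + 1)) - 1 : IwasawaAlgebra p)} • ⊤ : Submodule (IwasawaAlgebra p) F)) ≤
      Nat.card F := Nat.card_le_card_of_surjective _ (Submodule.mkQ_surjective _)
  have hFpos : 0 < Nat.card (F ⧸ (Ideal.span {((1 + PowerSeries.X : PowerSeries ℤ_[p]) ^ (p ^ (n + 1)) - 1 : IwasawaAlgebra p)} • ⊤ :
      Submodule (IwasawaAlgebra p) F)) := Nat.card_pos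
  -- positivity of `#(X'/ω_{n+1}X')`: `C > 0` (the product formula at `n₀` has positive factors) transported by Iwasawa exact
  have hX'pos : 0 < Nat.card ((M ⧸ F) ⧸ (Ideal.span {((1 + PowerSeries.X : PowerSeries ℤ_[p]) ^ (p ^ (n + 1)) - 1 : IwasawaAlgebra p)} • ⊤ :
      Submodule (IwasawaAlgebra p) (M ⧸ F))) := by
    -- every `X'/ω_mX'` is finite: `X'/TX'` (Greenberg Lemma 4.2, tree) and each `X'/Ψ_kX'` (`Ψ_k ∤ f`, file III)
    have hT : Finite (coinvariants p (M ⧸ F)) := (Summit.BirchSwinnertonDyer.Rank1Residual.X1.GeneratorBound.natCard_coinvariants_eq (M ⧸ F) hM' hF f hchar' h0).1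
    have hTpos : 0 < Nat.card ((M ⧸ F) ⧸ (Ideal.span {(PowerSeries.X : IwasawaAlgebra p)} • ⊤ : Submodule (IwasawaAlgebra p) (M ⧸ F))) := by
      haveI := hT; exact Nat.card_pos
    have hprod := natCard_quotient_omega_eq_mul_prod (M := M ⧸ F) hM' hF hchar' h0 (n := n + 1) (fun m _ ↦ hΨ m)
    rw [hprod]
    refine Nat.mul_pos hTpos (Finset.prod_pos fun k _ ↦ ?_)
    rw [natCard_quotient_smul_top_eq_natCard_quotient_span_sup (constantCoeff_cyclotomicLayer p k) (prime_coe_cyclotomic_comp p k) hM' hF hchar' (hΨ k)]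
    obtain ⟨v, hv⟩ := exists_natCard_quotient_span_sup_span_coe_eq_pow (constantCoeff_cyclotomicLayer p k) (prime_coe_cyclotomic_comp p k) (hΨ k)
    rw [hv]; exact pow_pos hp.out.pos _
  refine ⟨n, ?_, ?_⟩
  · rw [hsplit]; exact Nat.mul_pos hX'pos hFpos
  · rw [hsplit]
    have hCF : C * Nat.card F < p ^ (C * Nat.card F) := Nat.lt_pow_self hp.out.one_lt
    calc Nat.card ((M ⧸ F) ⧸ (Ideal.span {((1 + PowerSeries.X : PowerSeries ℤ_[p]) ^ (p ^ (n + 1)) - 1 : IwasawaAlgebra p)} • ⊤ :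
            Submodule (IwasawaAlgebra p) (M ⧸ F))) *
          Nat.card (F ⧸ (Ideal.span {((1 + PowerSeries.X : PowerSeries ℤ_[p]) ^ (p ^ (n + 1)) - 1 : IwasawaAlgebra p)} • ⊤ : Submodule (IwasawaAlgebra p) F))
        ≤ C * p ^ (lam f * (n + 1)) * Nat.card F := Nat.mul_le_mul hX'le hFle
      _ = p ^ (lam f * (n + 1)) * (C * Nat.card F) := by ring
      _ < p ^ (lam f * (n + 1)) * p ^ (C * Nat.card F) := Nat.mul_lt_mul_of_pos_left hCF (pow_pos hp.out.pos _)
      _ = p ^ (lam f * (n + 1) + C * Nat.card F) := by rw [pow_add]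
      _ ≤ p ^ (p ^ n * (p - 1)) := Nat.pow_le_pow_right hp.out.pos hlt.le

end Invariants

section InvariantsSelmer

variable {K : Type u} [Field K] [NumberField K] (W : WeierstrassCurve K) {p : ℕ} [hp : Fact p.Prime] (κ : ZpExtension K p)
  {γ : Field.absoluteGaloisGroup K}

/-- ★★★ **GREENBERG'S `μ = 0` IS «FEW INVARIANTS AT SOME LAYER».** `E/K`, `κ` any `ℤ_p`-extension with topological generator `γ`, `D` any dual datum with `X` f.g.
torsion, `char_Λ X = (f)`, `f` coprime to every `ω_n` (`f(0) ≠ 0`, `Ψ_m ∤ f` — the rank-0 tower: all `#Sel_∞^{Γ_n}` finite). Then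
**`μ(f) = 0 ⟺ ∃ n, 0 < #Sel_{p^∞}(E/K_∞)^{Γ_{n+1}} < p^{pⁿ(p−1)}`** (and `μ(X(E/K_∞)) = μ(f)`). [cite: GreenbergLNM1716, §1 pp. 60–65, Thm. 1.10, Conj. 1.11]
[cite: Washington1997, §13.3 Thm. 13.13, §13.4] -/
theorem mu_eq_zero_iff_exists_natCard_selmerInvariants_pos_lt (hγ : κ.IsTopGenerator γ) (D : W.SelmerDualData κ γ) [Module.Finite (IwasawaAlgebra p) D.X]
    (hD : D.IsTorsion) {f : IwasawaAlgebra p} (hchar : D.charIdeal = Ideal.span {f}) (h0 : PowerSeries.constantCoeff f ≠ 0)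
    (hΨ : ∀ m, ¬ ((((Polynomial.cyclotomic (p ^ (m + 1)) ℤ_[p]).comp (Polynomial.X + 1) : ℤ_[p][X]) : IwasawaAlgebra p) ∣ f)) :
    (mu f = 0 ↔ ∃ n : ℕ, 0 < Nat.card ↥(W.selmerInfty κ ⊓ W.layerInvariants κ (n + 1)) ∧
      Nat.card ↥(W.selmerInfty κ ⊓ W.layerInvariants κ (n + 1)) < p ^ (p ^ n * (p - 1))) ∧ D.mu = mu f := by
  have hf0 : f ≠ 0 := fun h ↦ h0 (by rw [h, map_zero])
  refine ⟨?_, (Summit.BirchSwinnertonDyer.Rank1Residual.X1.MuPart.mu_generator_eq_muInvariant D.X hD hf0 hchar).symm⟩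
  simp only [← natCard_layerQuotient_omega_eq_natCard_selmerInvariants W κ hγ D]
  exact mu_eq_zero_iff_exists_natCard_quotient_omega_succ_pos_lt (M := D.X) hD hchar h0 hΨ

end InvariantsSelmer

end Summit.BirchSwinnertonDyer.BirchSwinnertonDyer.Theorems.AlignedTransportAtTwoHalfDescentLayerIndexBounded

end
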